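import Summits.Ventures.Crystal3D.Theorems.StickyWulffConstantCoaxialWallLawBarlowPlateSources
import HarnessLib

/-!
# SOURCES of a word net for ANY root slot on the fcc RUNS of a clamped Barlow plate: the `hPsrc` clause, polar roots included ((β)-lite B3-lite)
# (lane T, crux `TextureLiminfV5`, stmt-Ventures-23912, line `TexShadow` v8.22, re-targeted `stub_terraceCensus`; 19480-p1 g20; memo BETA-LITE-g20 rev 3 §8 (N10))

HONEST FRAMING. Venture `Summits/Ventures/Crystal3D` (cell `crystal3d-full`), route `route-Ventures-StickyWulffConstant`, helper `--supports` the
law-v5 crux `TextureLiminfV5` (stmt-Ventures-23912), lane T.  Census-free, standard axioms; nothing about energies; F-C1 not moved.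

'…BarlowPlateSources' (19481-p1, p696624) delivers the source clause `hPsrc` of the plate-abstract word net `word_family_endPairs_plates` /
`word_endPairs_multi_plates` for BASAL root slots (`r 2 = 0`) at every layer that is not a c-layer of the other orientation.  The run-rich zone of
the (β)-lite plan needs the POLAR root classes too; on a Barlow plate those are STRAIGHT movers exactly on the c-layers `(+,+)` of the plate frame
`L` (resp. `(−,−)` of the mirror frame `basalMirror ≫ L`), where the ball is FULL (`isFull_plateBall` / `isFull_mirror_plateBall`, p690727).
This file records that case for an ARBITRARY root slot `r ∈ fccSlots`:
* `plateBall_source_frame_of_full_layer` / `plateBall_source_mirror_of_full_layer` — at a `(+,+)` (resp. `(−,−)`) layer: the ball is occupied, carries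
  an occupied `60°` face of the frame, has the predecessor `p − G r ∈ X`, and is FULL in the frame (so it is a straight mover for EVERY root slot);
* **`hPsrc_of_plateCore_frame_anyRoot`** / **`hPsrc_of_plateCore_mirror_anyRoot`** — the clause `hPsrc` VERBATIM for a finite core whose admissible balls
  lie on such layers, any root slot, given the invariant at the first target.
Memo §8: in EDGE-ON geometry these are the ONLY polar sources (walks reflected at a fault plane descend), which is why (β)-lite is a zone theorem for
run-rich Hägg words.  WHAT THIS IS NOT: not the flux count, not the sealing, not the cross-launch (zigzag) extension; F-C1 not moved.
-/

noncomputable section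

namespace Summit.Ventures.Crystal3D.Theorems

open Summit.Ventures.Crystal3D Finset
open Literature.MathematicalPhysics.StatisticalMechanics (barlowPos barlowStacking IsHaggSeq barlowPos_mem basalMirror
  basalMirror_apply_coord)
open Summit.Ventures.Crystal3D.Cruxes.TextureLiminf.TexShadow (E3 stacking)
open scoped InnerProductSpace

section Plate

variable {σ : ℤ → ℤ} (L : E3 ≃ₗᵢ[ℝ] E3) (s : E3) {X : Finset E3}
  (hsep : ∀ p ∈ X, ∀ p' ∈ X, p ≠ p' → 1 ≤ dist p p') {W : Set E3}
  (hplate : ∀ p ∈ stacking L s σ, p ∈ W → p ∈ X) (k i j : ℤ)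
  (hW : ∀ x, dist (L (barlowPos 1 (Real.sqrt (2 / 3)) σ k i j) + s) x ≤ 2 → x ∈ W)

include hsep hplate hW

open scoped Classical in
/-- **SOURCE CLAUSE at a `(+,+)` layer, plate frame `L`, ANY root slot `r`**: occupied, an occupied face, the predecessor `p − L r`, and FULL in `L`. -/
theorem plateBall_source_frame_of_full_layer (h₁ : σ (k - 1) = 1) (h₂ : σ k = 1) {r : E3} (hr : r ∈ fccSlots) :
    L (barlowPos 1 (Real.sqrt (2 / 3)) σ k i j) + s ∈ X ∧
    (∃ a ∈ fccSlots, ∃ a' ∈ fccSlots, ∃ a'' ∈ fccSlots,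
      ⟪a, a'⟫_ℝ = 1 / 2 ∧ ⟪a, a''⟫_ℝ = 1 / 2 ∧ ⟪a', a''⟫_ℝ = 1 / 2 ∧
      L (barlowPos 1 (Real.sqrt (2 / 3)) σ k i j) + s + L a ∈ X ∧
      L (barlowPos 1 (Real.sqrt (2 / 3)) σ k i j) + s + L a' ∈ X ∧
      L (barlowPos 1 (Real.sqrt (2 / 3)) σ k i j) + s + L a'' ∈ X) ∧
    L (barlowPos 1 (Real.sqrt (2 / 3)) σ k i j) + s - L r ∈ X ∧
    IsFull X L (L (barlowPos 1 (Real.sqrt (2 / 3)) σ k i j) + s) := by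
  have hf := isFull_plateBall L s hsep hplate k i j hW h₁ h₂
  exact ⟨plateBall_mem L s hplate k i j hW, face_of_isFull L hf, sub_mem_of_isFull L hf hr, hf⟩

open scoped Classical in
/-- **SOURCE CLAUSE at a `(−,−)` layer, mirror frame `basalMirror ≫ L`, ANY root slot `r`.** -/
theorem plateBall_source_mirror_of_full_layer (h₁ : σ (k - 1) = -1) (h₂ : σ k = -1) {r : E3} (hr : r ∈ fccSlots) :
    L (barlowPos 1 (Real.sqrt (2 / 3)) σ k i j) + s ∈ X ∧
    (∃ a ∈ fccSlots, ∃ a' ∈ fccSlots, ∃ a'' ∈ fccSlots,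
      ⟪a, a'⟫_ℝ = 1 / 2 ∧ ⟪a, a''⟫_ℝ = 1 / 2 ∧ ⟪a', a''⟫_ℝ = 1 / 2 ∧
      L (barlowPos 1 (Real.sqrt (2 / 3)) σ k i j) + s + (basalMirror.trans L) a ∈ X ∧
      L (barlowPos 1 (Real.sqrt (2 / 3)) σ k i j) + s + (basalMirror.trans L) a' ∈ X ∧
      L (barlowPos 1 (Real.sqrt (2 / 3)) σ k i j) + s + (basalMirror.trans L) a'' ∈ X) ∧
    L (barlowPos 1 (Real.sqrt (2 / 3)) σ k i j) + s - (basalMirror.trans L) r ∈ X ∧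
    IsFull X (basalMirror.trans L) (L (barlowPos 1 (Real.sqrt (2 / 3)) σ k i j) + s) := by
  have hf := isFull_mirror_plateBall L s hsep hplate k i j hW h₁ h₂
  exact ⟨plateBall_mem L s hplate k i j hW, face_of_isFull _ hf, sub_mem_of_isFull _ hf hr, hf⟩

end Plate

/-! ### The clause `hPsrc` verbatim for a core on the fcc runs, any root slot -/

section Core

variable {σ : ℤ → ℤ} (L : E3 ≃ₗᵢ[ℝ] E3) (s : E3) {X : Finset E3}
  (hsep : ∀ p ∈ X, ∀ p' ∈ X, p ≠ p' → 1 ≤ dist p p') {W : Set E3}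
  (hplate : ∀ p ∈ stacking L s σ, p ∈ W → p ∈ X)
  (ver : WordVersion) {F : List E3 → (E3 ≃ₗᵢ[ℝ] E3)} {r : E3} (hr : r ∈ fccSlots)
  {P : E3 × List E3 → Prop} (P' : Finset E3) (srcOK : E3 → Prop)

include hsep hplate hr

open scoped Classical in
/-- **`hPsrc` for the plate frame, ANY root slot** (`F [] = L`): admissible core balls lie on `(+,+)` layers deep in the clamped region and carry the
invariant at their first target. -/
theorem hPsrc_of_plateCore_frame_anyRoot (hF0 : F [] = L)
    (hadm : ∀ p ∈ P', srcOK p → ∃ k i j : ℤ, p = L (barlowPos 1 (Real.sqrt (2 / 3)) σ k i j) + s ∧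
      (∀ x, dist p x ≤ 2 → x ∈ W) ∧ σ (k - 1) = 1 ∧ σ k = 1)
    (hP : ∀ p ∈ P', srcOK p → P (p + F [] r, [])) :
    ∀ p ∈ P', srcOK p → p ∈ X ∧
      (∃ a ∈ fccSlots, ∃ a' ∈ fccSlots, ∃ a'' ∈ fccSlots,
        ⟪a, a'⟫_ℝ = 1 / 2 ∧ ⟪a, a''⟫_ℝ = 1 / 2 ∧ ⟪a', a''⟫_ℝ = 1 / 2 ∧
        p + F [] a ∈ X ∧ p + F [] a' ∈ X ∧ p + F [] a'' ∈ X) ∧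
      p - F [] r ∈ X ∧
      (IsFull X (F []) p ∨ (∃ m, IsTwinReading X (F []) m p ∧ ⟪F [] r, m⟫_ℝ = 0) ∨
        (ver = WordVersion.v2 ∧ IsNarrow X (F []) (F [] r) p)) ∧
      P (p + F [] r, []) := by
  intro p hp hok
  obtain ⟨k, i, j, rfl, hW, h₁, h₂⟩ := hadm p hp hok
  obtain ⟨hmem, hface, hpred, hf⟩ := plateBall_source_frame_of_full_layer L s hsep hplate k i j hW h₁ h₂ hr
  rw [hF0]
  refine ⟨hmem, hface, hpred, Or.inl hf, ?_⟩
  have := hP _ hp hok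
  rwa [hF0] at this

open scoped Classical in
/-- **`hPsrc` for the mirror frame, ANY root slot** (`F [] = basalMirror ≫ L`): admissible core balls lie on `(−,−)` layers. -/
theorem hPsrc_of_plateCore_mirror_anyRoot (hF0 : F [] = basalMirror.trans L)
    (hadm : ∀ p ∈ P', srcOK p → ∃ k i j : ℤ, p = L (barlowPos 1 (Real.sqrt (2 / 3)) σ k i j) + s ∧
      (∀ x, dist p x ≤ 2 → x ∈ W) ∧ σ (k - 1) = -1 ∧ σ k = -1)
    (hP : ∀ p ∈ P', srcOK p → P (p + F [] r, [])) :
    ∀ p ∈ P', srcOK p → p ∈ X ∧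
      (∃ a ∈ fccSlots, ∃ a' ∈ fccSlots, ∃ a'' ∈ fccSlots,
        ⟪a, a'⟫_ℝ = 1 / 2 ∧ ⟪a, a''⟫_ℝ = 1 / 2 ∧ ⟪a', a''⟫_ℝ = 1 / 2 ∧
        p + F [] a ∈ X ∧ p + F [] a' ∈ X ∧ p + F [] a'' ∈ X) ∧
      p - F [] r ∈ X ∧
      (IsFull X (F []) p ∨ (∃ m, IsTwinReading X (F []) m p ∧ ⟪F [] r, m⟫_ℝ = 0) ∨
        (ver = WordVersion.v2 ∧ IsNarrow X (F []) (F [] r) p)) ∧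
      P (p + F [] r, []) := by
  intro p hp hok
  obtain ⟨k, i, j, rfl, hW, h₁, h₂⟩ := hadm p hp hok
  obtain ⟨hmem, hface, hpred, hf⟩ := plateBall_source_mirror_of_full_layer L s hsep hplate k i j hW h₁ h₂ hr
  rw [hF0]
  refine ⟨hmem, hface, hpred, Or.inl hf, ?_⟩
  have := hP _ hp hok
  rwa [hF0] at this

end Core

end Summit.Ventures.Crystal3D.Theorems

end
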